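import Mathlib.MeasureTheory.Measure.Lebesgue.VolumeOfBalls
import Literature.MathematicalPhysics.StatisticalMechanics.Theil2006Decay
import HarnessLib

/-!
# Theil 2006, §2.4 p. 12: counting `(1 − α)`-separated particles in discs and annuli — «(13)
implies at most `C d²` labels in `B(y(x_b), ·)` and `C d` labels with `||y(x) − y(x′)| − d| ≤ ½`»

Topic `Literature/MathematicalPhysics/StatisticalMechanics`; companion of `Theil2006.lean`
((13): `1 − α < |y(x) − y(x')|` for `x ≠ x'`). Everything here is PROVED (no `sorry`, no named
fact; D-0026). These are the two elementary consequences of the minimum-distance bound (13) that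
the proof of (40) (p. 12) — and, in the same way, (28) and the proof of Lemma 3.1 — use; the
paper states them without proof and without constants. We prove them by the area (packing)
argument: the discs of radius `ρ = (1 − α)/2` around the particles are pairwise disjoint.

## Source, as printed (preprint p. 12, proof of (40))

"To see this we first apply Proposition 2.8.3 and obtain that for each index pair
`{x, x'} ∈ ℒ₀` there exist `x_b ∈ ∂X` such that `y(x) ∈ B(y(x_b), 28|y(x) − y(x')|)`. The lower
bound on the minimum distance between particles (13) implies that for every `x_b ∈ ∂X` there are
at most `C d²` labels `x ∈ X` such that `y(x) ∈ B(y(x_b), 28|y(x) − y(x')|)` and `C d` labels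
`x' ∈ X` such that `||y(x) − y(x')| − d| ≤ ½`. This proves (40)."

## What is here

* `Theil2006.volume_biUnion_ball_of_separated` — for `2ρ`-separated points the discs `B(z_i, ρ)`
  are disjoint, of total area `#s · πρ²`.
* `Theil2006.card_mul_sq_le_of_subset_closedBall`, `Theil2006.card_mul_sq_add_sq_le` — the packing
  inequalities `#s ρ² ≤ r²` (discs inside `B̄(p, r)`) and `#s ρ² + r₁² ≤ r₂²` (discs inside
  `B̄(p, r₂)` and off `B̄(p, r₁)`), for any finite family of labels of any index type.
* `Theil2006.card_le_of_dist_le` — **disc count under (13)**: at most `4(2R + 1)²` particles of a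
  `(1 − α)`-separated family (`0 < α ≤ ½`) lie in `B̄(p, R)`.
* `Theil2006.card_le_of_abs_dist_sub_le` — **annulus count under (13)**: at most `64(d + 1)`
  particles satisfy `||y(x) − p| − d| ≤ ½` (`d ≥ 0`).
* `Fin N` forms `Theil2006.card_filter_dist_le_le`, `Theil2006.card_filter_abs_dist_sub_le_le`
  for configurations `y : X_N → ℝ²` with (13), as on p. 12.
* `Theil2006.card_pairs_le_of_near` — the pair count behind (40): pairs whose first particle is
  within `R` of a defect and whose length is within `½` of `c` number at most
  `#∂X · 4(2R+1)² · 64(c+1)`.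
* `Theil2006.IsAdmissible.sum_negPart_le_of_near_defects` — **(40)–(41) from Proposition 2.8.3**:
  for any finite set `P` of pairs of length `≥ 1 + α` (long-range pairs) each of which has a
  defect within `K` times its length of its first particle (the conclusion of Proposition 2.8.3
  for `ℒ₀ ∪ ℒ₁`, taken as a HYPOTHESIS on `P`), the negative parts of the pair energies sum to at
  most `10240 (2K+1)² α #∂X` ("By (4) and (5)": `V ≥ −α` on `[1+α, 4/3]`, `|V(r)| ≤ α r⁻⁵` beyond,
  shells of unit width, the two counts above, and `Σ_d (d + 4/3)⁻² ≤ 3`); hence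
  `Theil2006.IsAdmissible.sum_mul_ge_of_near_defects`: `Σ_{p ∈ P} w_p e(p) ≥ −10240(2K+1)² α #∂X`
  for weights `w_p ∈ [0, 1]` — the shape of (41) `I₄ + I₅ = Σ_{ℒ₀} e + ½ Σ_{ℒ₁} e ≥ −Cα #∂X`.

Proposition 2.8.3 itself ("if `#𝒯(x₁,x₂) ≤ 1` then `y(∂X) ∩ B(½(y(x₁)+y(x₂)), 28|y(x₁) − y(x₂)|) ≠ ∅`",
Appendix) is NOT proved here; with it, `K = 29` serves for `P = ℒ₀ ∪ ℒ₁`.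
-/

noncomputable section

open scoped BigOperators
open Set Metric MeasureTheory

namespace Literature.MathematicalPhysics.StatisticalMechanics

namespace Theil2006

/-! ### Packing by area -/

section Packing

variable {ι : Type*}

/-- The area of a disc of radius `ρ ≥ 0` in `ℝ²` is `πρ²`. [folklore] -/
private theorem volume_ball_plane (x : Plane) {ρ : ℝ} (hρ : 0 ≤ ρ) :
    volume (ball x ρ) = ENNReal.ofReal (ρ ^ 2 * Real.pi) := by
  rw [EuclideanSpace.volume_ball_fin_two, ENNReal.ofReal_mul (sq_nonneg _), ENNReal.ofReal_pow hρ]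

/-- The area of a closed disc of radius `r ≥ 0` in `ℝ²` is `πr²`. [cite: Theil2006, §2.4 proof of (40) (preprint p. 12); our lemma] -/
theorem volume_closedBall_plane (x : Plane) {r : ℝ} (hr : 0 ≤ r) :
    volume (closedBall x r) = ENNReal.ofReal (r ^ 2 * Real.pi) := by
  rw [EuclideanSpace.volume_closedBall_fin_two, ENNReal.ofReal_mul (sq_nonneg _),
    ENNReal.ofReal_pow hr]

/-- **Disjoint discs**: for `2ρ`-separated points `z_i` (`i ∈ s`), the discs `B(z_i, ρ)` are
pairwise disjoint and `meas(⋃_{i ∈ s} B(z_i, ρ)) = #s · πρ²`. [folklore] -/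
private theorem volume_biUnion_ball_of_separated (s : Finset ι) (z : ι → Plane) {ρ : ℝ} (hρ : 0 ≤ ρ)
    (hsep : ∀ i ∈ s, ∀ j ∈ s, i ≠ j → 2 * ρ ≤ dist (z i) (z j)) :
    volume (⋃ i ∈ s, ball (z i) ρ) = ENNReal.ofReal (s.card * (ρ ^ 2 * Real.pi)) := by
  have hdisj : (s : Set ι).PairwiseDisjoint fun i => ball (z i) ρ := by
    intro i hi j hj hij
    exact ball_disjoint_ball (by linarith [hsep i hi j hj hij])
  rw [measure_biUnion_finset hdisj fun i _ => measurableSet_ball]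
  simp_rw [volume_ball_plane _ hρ]
  rw [Finset.sum_const, nsmul_eq_mul, ← ENNReal.ofReal_natCast, ← ENNReal.ofReal_mul (Nat.cast_nonneg _)]

/-- **Packing inequality, disc**: `2ρ`-separated points whose `ρ`-discs lie in `B̄(p, r)` number
at most `r²/ρ²`: `#s · ρ² ≤ r²`. [folklore] -/
private theorem card_mul_sq_le_of_subset_closedBall (s : Finset ι) (z : ι → Plane) {ρ : ℝ} (hρ : 0 ≤ ρ)
    (hsep : ∀ i ∈ s, ∀ j ∈ s, i ≠ j → 2 * ρ ≤ dist (z i) (z j)) {p : Plane} {r : ℝ} (hr : 0 ≤ r)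
    (hin : ∀ i ∈ s, ball (z i) ρ ⊆ closedBall p r) : (s.card : ℝ) * ρ ^ 2 ≤ r ^ 2 := by
  have hsub : (⋃ i ∈ s, ball (z i) ρ) ⊆ closedBall p r := iUnion₂_subset hin
  have h := measure_mono (μ := volume) hsub
  rw [volume_biUnion_ball_of_separated s z hρ hsep, volume_closedBall_plane p hr,
    ENNReal.ofReal_le_ofReal_iff (by positivity)] at h
  have hπ := Real.pi_pos
  nlinarith

/-- **Packing inequality, annulus**: `2ρ`-separated points whose `ρ`-discs lie in `B̄(p, r₂)` and
miss `B̄(p, r₁)` (`0 ≤ r₁ ≤ r₂`) satisfy `#s · ρ² + r₁² ≤ r₂²`. [folklore] -/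
private theorem card_mul_sq_add_sq_le (s : Finset ι) (z : ι → Plane) {ρ : ℝ} (hρ : 0 ≤ ρ)
    (hsep : ∀ i ∈ s, ∀ j ∈ s, i ≠ j → 2 * ρ ≤ dist (z i) (z j)) {p : Plane} {r₁ r₂ : ℝ}
    (hr₁ : 0 ≤ r₁) (h12 : r₁ ≤ r₂) (hin : ∀ i ∈ s, ball (z i) ρ ⊆ closedBall p r₂)
    (hout : ∀ i ∈ s, Disjoint (ball (z i) ρ) (closedBall p r₁)) :
    (s.card : ℝ) * ρ ^ 2 + r₁ ^ 2 ≤ r₂ ^ 2 := by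
  have hr₂ : 0 ≤ r₂ := hr₁.trans h12
  have hsub : (⋃ i ∈ s, ball (z i) ρ) ∪ closedBall p r₁ ⊆ closedBall p r₂ :=
    union_subset (iUnion₂_subset hin) (closedBall_subset_closedBall h12)
  have hdisj : Disjoint (⋃ i ∈ s, ball (z i) ρ) (closedBall p r₁) := by
    rw [disjoint_iUnion₂_left]
    exact hout
  have h := measure_mono (μ := volume) hsub
  rw [measure_union hdisj measurableSet_closedBall, volume_biUnion_ball_of_separated s z hρ hsep,
    volume_closedBall_plane p hr₁, volume_closedBall_plane p hr₂,
    ← ENNReal.ofReal_add (by positivity) (by positivity),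
    ENNReal.ofReal_le_ofReal_iff (by positivity)] at h
  have hπ := Real.pi_pos
  nlinarith

end Packing

/-! ### Counting under the minimum-distance bound (13) -/

section Counting

variable {X : Type*} {α : ℝ} {y : X → Plane}

/-- **Disc count under (13)**: if the particles `y(x)`, `x ∈ s`, are pairwise more than `1 − α`
apart (`0 < α ≤ ½`), at most `4(2R + 1)²` of them lie in `B̄(p, R)`.
[cite: Theil2006, §2.4 proof of (40) («(13) implies that … there are at most C d² labels x ∈ X such that y(x) ∈ B(y(x_b), ·)», preprint p. 12); constants ours] -/
theorem card_le_of_dist_le (hα0 : 0 < α) (hα : α ≤ 1 / 2) (s : Finset X)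
    (hsep : ∀ x ∈ s, ∀ x' ∈ s, x ≠ x' → 1 - α < dist (y x) (y x')) (p : Plane) {R : ℝ}
    (hR : 0 ≤ R) (hs : ∀ x ∈ s, dist (y x) p ≤ R) : (s.card : ℝ) ≤ 4 * (2 * R + 1) ^ 2 := by
  set ρ : ℝ := (1 - α) / 2 with hρ
  have hρ0 : 0 ≤ ρ := by rw [hρ]; linarith
  have hρ4 : 1 / 4 ≤ ρ := by rw [hρ]; linarith
  have hsep' : ∀ x ∈ s, ∀ x' ∈ s, x ≠ x' → 2 * ρ ≤ dist (y x) (y x') := fun x hx x' hx' hne => by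
    rw [hρ]; linarith [hsep x hx x' hx' hne]
  have hin : ∀ x ∈ s, ball (y x) ρ ⊆ closedBall p (R + 1 / 2) := by
    intro x hx z hz
    rw [mem_ball] at hz
    rw [mem_closedBall]
    have := dist_triangle z (y x) p
    have hρ2 : ρ ≤ 1 / 2 := by rw [hρ]; linarith
    linarith [hs x hx]
  have h := card_mul_sq_le_of_subset_closedBall s y hρ0 hsep' (by linarith) hin
  have hc : (0 : ℝ) ≤ s.card := Nat.cast_nonneg _
  -- `#s ≤ (R + ½)² / ρ² ≤ 16 (R + ½)² = 4 (2R + 1)²`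
  nlinarith [mul_le_mul_of_nonneg_left (mul_le_mul hρ4 hρ4 (by norm_num) hρ0) hc]

/-- **Annulus count under (13)**: if the particles `y(x)`, `x ∈ s`, are pairwise more than
`1 − α` apart (`0 < α ≤ ½`), at most `64(d + 1)` of them satisfy `||y(x) − p| − d| ≤ ½`
(`d ≥ 0`). [cite: Theil2006, §2.4 proof of (40) («… and C d labels x′ ∈ X such that ||y(x) − y(x′)| − d| ≤ ½», preprint p. 12); constants ours] -/
theorem card_le_of_abs_dist_sub_le (hα0 : 0 < α) (hα : α ≤ 1 / 2) (s : Finset X)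
    (hsep : ∀ x ∈ s, ∀ x' ∈ s, x ≠ x' → 1 - α < dist (y x) (y x')) (p : Plane) {d : ℝ}
    (hd : 0 ≤ d) (hs : ∀ x ∈ s, |dist (y x) p - d| ≤ 1 / 2) : (s.card : ℝ) ≤ 64 * (d + 1) := by
  by_cases hd1 : d ≤ 1
  · -- a disc of radius `d + ½ ≤ 3/2`
    have h := card_le_of_dist_le hα0 hα s hsep p (R := d + 1 / 2) (by linarith)
      (fun x hx => by linarith [(abs_le.1 (hs x hx)).2])
    nlinarith
  · rw [not_le] at hd1
    set ρ : ℝ := (1 - α) / 2 with hρ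
    have hρ0 : 0 ≤ ρ := by rw [hρ]; linarith
    have hρ4 : 1 / 4 ≤ ρ := by rw [hρ]; linarith
    have hρ2 : ρ < 1 / 2 := by rw [hρ]; linarith
    have hsep' : ∀ x ∈ s, ∀ x' ∈ s, x ≠ x' → 2 * ρ ≤ dist (y x) (y x') :=
      fun x hx x' hx' hne => by rw [hρ]; linarith [hsep x hx x' hx' hne]
    have hin : ∀ x ∈ s, ball (y x) ρ ⊆ closedBall p (d + 1) := by
      intro x hx z hz
      rw [mem_ball] at hz
      rw [mem_closedBall]
      have := dist_triangle z (y x) p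
      linarith [(abs_le.1 (hs x hx)).2]
    have hout : ∀ x ∈ s, Disjoint (ball (y x) ρ) (closedBall p (d - 1)) := by
      intro x hx
      rw [Set.disjoint_left]
      intro z hz hz'
      rw [mem_ball] at hz
      rw [mem_closedBall] at hz'
      have := dist_triangle (y x) z p
      rw [dist_comm (y x) z] at this
      linarith [(abs_le.1 (hs x hx)).1]
    have h := card_mul_sq_add_sq_le s y hρ0 hsep' (by linarith : (0 : ℝ) ≤ d - 1) (by linarith)
      hin hout
    have hc : (0 : ℝ) ≤ s.card := Nat.cast_nonneg _
    -- `#s ρ² ≤ (d+1)² − (d−1)² = 4d`, `ρ ≥ ¼`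
    nlinarith [mul_le_mul_of_nonneg_left (mul_le_mul hρ4 hρ4 (by norm_num) hρ0) hc]

end Counting

/-! ### The `X_N` forms of p. 12 -/

section Finite

variable {α : ℝ} {N : ℕ} {y : Fin N → Plane}

/-- **p. 12, first count**: under (13) (`0 < α ≤ ½`), for every `p ∈ ℝ²` and `R ≥ 0` at most
`4(2R + 1)²` labels `x ∈ X_N` have `y(x) ∈ B̄(p, R)`.
[cite: Theil2006, §2.4 proof of (40) (preprint p. 12); constants ours] -/
theorem card_filter_dist_le_le (hα0 : 0 < α) (hα : α ≤ 1 / 2)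
    (hsep : ∀ i j : Fin N, i ≠ j → 1 - α < dist (y i) (y j)) (p : Plane) {R : ℝ} (hR : 0 ≤ R) :
    (((Finset.univ.filter fun x : Fin N => dist (y x) p ≤ R).card : ℕ) : ℝ) ≤
      4 * (2 * R + 1) ^ 2 :=
  card_le_of_dist_le hα0 hα _ (fun x _ x' _ hne => hsep x x' hne) p hR
    fun _ hx => (Finset.mem_filter.1 hx).2

/-- **p. 12, second count**: under (13) (`0 < α ≤ ½`), for every `p ∈ ℝ²` and `d ≥ 0` at most
`64(d + 1)` labels `x ∈ X_N` satisfy `||y(x) − p| − d| ≤ ½`.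
[cite: Theil2006, §2.4 proof of (40) (preprint p. 12); constants ours] -/
theorem card_filter_abs_dist_sub_le_le (hα0 : 0 < α) (hα : α ≤ 1 / 2)
    (hsep : ∀ i j : Fin N, i ≠ j → 1 - α < dist (y i) (y j)) (p : Plane) {d : ℝ} (hd : 0 ≤ d) :
    (((Finset.univ.filter fun x : Fin N => |dist (y x) p - d| ≤ 1 / 2).card : ℕ) : ℝ) ≤
      64 * (d + 1) :=
  card_le_of_abs_dist_sub_le hα0 hα _ (fun x _ x' _ hne => hsep x x' hne) p hd
    fun _ hx => (Finset.mem_filter.1 hx).2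

end Finite

/-! ### (40)–(41): long-range pairs near defects cost `O(α) #∂X` -/

section LongRangePairs

variable {α : ℝ} {V : ℝ → ℝ} {N : ℕ} {y : Fin N → Plane}

/-- `Σ_{d < D} (d + 4/3)⁻² ≤ 3` (telescoping against `1/(d + ⅓) − 1/(d + 4/3)`). [folklore] -/
private theorem sum_range_inv_add_sq_le (D : ℕ) :
    ∑ d ∈ Finset.range D, ((d : ℝ) + 4 / 3)⁻¹ ^ 2 ≤ 3 := by
  have h : ∀ d : ℕ, ((d : ℝ) + 4 / 3)⁻¹ ^ 2 ≤ 1 / ((d : ℝ) + 1 / 3) - 1 / ((d : ℝ) + 4 / 3) := by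
    intro d
    have h0 : (0 : ℝ) < (d : ℝ) + 1 / 3 := by positivity
    have h1 : (0 : ℝ) < (d : ℝ) + 4 / 3 := by positivity
    rw [inv_pow, div_sub_div _ _ h0.ne' h1.ne', inv_eq_one_div, div_le_div_iff₀ (by positivity)
      (by positivity)]
    nlinarith
  have htel : ∀ D : ℕ, ∑ d ∈ Finset.range D, (1 / ((d : ℝ) + 1 / 3) - 1 / ((d : ℝ) + 4 / 3)) =
      3 - 1 / ((D : ℝ) + 1 / 3) := by
    intro D
    induction D with
    | zero => norm_num
    | succ D ih =>
      rw [Finset.sum_range_succ, ih]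
      push_cast
      field_simp
      ring
  calc ∑ d ∈ Finset.range D, ((d : ℝ) + 4 / 3)⁻¹ ^ 2
      ≤ ∑ d ∈ Finset.range D, (1 / ((d : ℝ) + 1 / 3) - 1 / ((d : ℝ) + 4 / 3)) :=
        Finset.sum_le_sum fun d _ => h d
    _ = 3 - 1 / ((D : ℝ) + 1 / 3) := htel D
    _ ≤ 3 := by
        have : 0 < 1 / ((D : ℝ) + 1 / 3) := by positivity
        linarith

/-- **The pair count behind (40).** If every pair of `Q` has its first particle within `R` of a
particle of `S` (the defects) and length within `½` of `c`, then
`#Q ≤ #S · 4(2R + 1)² · 64(c + 1)` ((13), `0 < α ≤ ½`).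
[cite: Theil2006, §2.4 proof of (40) (preprint p. 12); constants ours] -/
theorem card_pairs_le_of_near (hα0 : 0 < α) (hα : α ≤ 1 / 2)
    (hsep : ∀ i j : Fin N, i ≠ j → 1 - α < dist (y i) (y j)) (S : Finset (Fin N))
    (Q : Finset (Fin N × Fin N)) {R c : ℝ} (hR : 0 ≤ R) (hc : 0 ≤ c)
    (hQ : ∀ p ∈ Q, (∃ b ∈ S, dist (y p.1) (y b) ≤ R) ∧ |dist (y p.1) (y p.2) - c| ≤ 1 / 2) :
    (Q.card : ℝ) ≤ S.card * (4 * (2 * R + 1) ^ 2) * (64 * (c + 1)) := by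
  classical
  set A : Fin N → Finset (Fin N) := fun b => Finset.univ.filter fun x => dist (y x) (y b) ≤ R
    with hA
  set T : Fin N → Finset (Fin N) := fun x =>
    Finset.univ.filter fun x' => |dist (y x') (y x) - c| ≤ 1 / 2 with hT
  have hsub : Q ⊆ S.biUnion fun b => (A b).biUnion fun x => (T x).image (Prod.mk x) := by
    intro p hp
    obtain ⟨⟨b, hb, hbR⟩, hpc⟩ := hQ p hp
    refine Finset.mem_biUnion.2 ⟨b, hb, Finset.mem_biUnion.2 ⟨p.1, ?_, ?_⟩⟩
    · rw [hA, Finset.mem_filter]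
      exact ⟨Finset.mem_univ _, hbR⟩
    · refine Finset.mem_image.2 ⟨p.2, ?_, rfl⟩
      rw [hT, Finset.mem_filter, dist_comm]
      exact ⟨Finset.mem_univ _, hpc⟩
  have hTle : ∀ x, ((T x).card : ℝ) ≤ 64 * (c + 1) := fun x =>
    card_filter_abs_dist_sub_le_le hα0 hα hsep (y x) hc
  have hAle : ∀ b, ((A b).card : ℝ) ≤ 4 * (2 * R + 1) ^ 2 := fun b =>
    card_filter_dist_le_le hα0 hα hsep (y b) hR
  have h1 : Q.card ≤ ∑ b ∈ S, ∑ x ∈ A b, (T x).card := by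
    refine (Finset.card_le_card hsub).trans ((Finset.card_biUnion_le).trans ?_)
    refine Finset.sum_le_sum fun b _ => (Finset.card_biUnion_le).trans ?_
    exact Finset.sum_le_sum fun x _ => Finset.card_image_le
  have h2 : ((Q.card : ℕ) : ℝ) ≤ ∑ b ∈ S, ∑ x ∈ A b, ((T x).card : ℝ) := by exact_mod_cast h1
  calc (Q.card : ℝ) ≤ ∑ b ∈ S, ∑ x ∈ A b, ((T x).card : ℝ) := h2
    _ ≤ ∑ b ∈ S, ∑ x ∈ A b, 64 * (c + 1) :=
        Finset.sum_le_sum fun b _ => Finset.sum_le_sum fun x _ => hTle x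
    _ = ∑ b ∈ S, ((A b).card : ℝ) * (64 * (c + 1)) := by
        refine Finset.sum_congr rfl fun b _ => ?_
        rw [Finset.sum_const, nsmul_eq_mul]
    _ ≤ ∑ b ∈ S, 4 * (2 * R + 1) ^ 2 * (64 * (c + 1)) :=
        Finset.sum_le_sum fun b _ => mul_le_mul_of_nonneg_right (hAle b) (by positivity)
    _ = S.card * (4 * (2 * R + 1) ^ 2) * (64 * (c + 1)) := by
        rw [Finset.sum_const, nsmul_eq_mul]
        ring
set_option maxHeartbeats 400000 in
/-- **Theil 2006, (40)–(41) from Proposition 2.8.3: long-range pairs near defects cost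
`O(α) #∂X`.** Let `V` satisfy (1)–(5), `0 < α ≤ ½`, `y : X_N → ℝ²` satisfy (13), and let `P` be a
finite set of pairs of length `≥ 1 + α` such that every `{x, x'} ∈ P` has a defect `x_b ∈ ∂X`
with `|y(x) − y(x_b)| ≤ K |y(x) − y(x')|` (the conclusion of Proposition 2.8.3 for
`P = ℒ₀ ∪ ℒ₁`, with `K = 29`; taken here as a hypothesis). Then the negative parts of the pair
energies satisfy `Σ_{p ∈ P} (e(p))⁻ ≤ 10240 (2K+1)² α #∂X`. Proof as printed: shells of unit
width in the pair length; in the shell `[d + 4/3, d + 7/3)` (12) gives `|V| ≤ α (d + 4/3)⁻⁵`,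
below `4/3` (4) gives `V ≥ −α`; the shell holds `≤ #∂X · 4(2K(d + 7/3) + 1)² · 64(d + 17/6)`
pairs ((40), by `card_pairs_le_of_near`); the series is `≤ 3072(2K+1)² Σ_d (d + 4/3)⁻² ≤ 9216(2K+1)²`; the near shell adds `≤ 1024(2K+1)²`.
[cite: Theil2006, §2.4 (40)–(41) (preprint p. 12); constants ours] -/
theorem IsAdmissible.sum_negPart_le_of_near_defects (hV : IsAdmissible α V) (hα0 : 0 < α)
    (hα : α ≤ 1 / 2) (hsep : ∀ i j : Fin N, i ≠ j → 1 - α < dist (y i) (y j))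
    (P : Finset (Fin N × Fin N)) (hlong : ∀ p ∈ P, 1 + α ≤ dist (y p.1) (y p.2)) {K : ℝ}
    (hK : 0 ≤ K)
    (hnear : ∀ p ∈ P, ∃ b ∈ defects α y, dist (y p.1) (y b) ≤ K * dist (y p.1) (y p.2)) :
    ∑ p ∈ P, max (-V (dist (y p.1) (y p.2))) 0 ≤
      10240 * (2 * K + 1) ^ 2 * α * (defects α y).card := by
  classical
  set B : ℝ := ((defects α y).card : ℝ) with hB
  have hB0 : 0 ≤ B := Nat.cast_nonneg _
  -- the shell index: `0` below `4/3`, `d + 1` on `[d + 4/3, d + 7/3)`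
  set r : Fin N × Fin N → ℝ := fun p => dist (y p.1) (y p.2) with hr
  set σ : Fin N × Fin N → ℕ := fun p => if r p < 4 / 3 then 0 else ⌊r p - 4 / 3⌋₊ + 1 with hσ
  have hσ0 : ∀ p, σ p = 0 → r p < 4 / 3 := by
    intro p h
    by_contra hlt
    simp [hσ, hlt] at h
  have hσS : ∀ p d, σ p = d + 1 → (d : ℝ) + 4 / 3 ≤ r p ∧ r p < (d : ℝ) + 7 / 3 := by
    intro p d h
    by_cases hlt : r p < 4 / 3
    · simp [hσ, hlt] at h
    · rw [not_lt] at hlt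
      simp only [hσ, if_neg (not_lt.2 hlt), add_left_inj] at h
      have h' := (Nat.floor_eq_iff (by linarith : 0 ≤ r p - 4 / 3)).1 h
      constructor <;> linarith [h'.1, h'.2]
  -- the weights `a d`: `α` below `4/3`, `α (d + 4/3)⁻⁵` on the shell `d + 1`
  set a : ℕ → ℝ := fun d => Nat.rec 1 (fun d' _ => ((d' : ℝ) + 4 / 3)⁻¹ ^ 5) d with ha
  have ha0 : a 0 = 1 := rfl
  have haS : ∀ d : ℕ, a (d + 1) = ((d : ℝ) + 4 / 3)⁻¹ ^ 5 := fun d => rfl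
  -- per pair: `(e(p))⁻ ≤ α a (σ p)`
  have hpair : ∀ p ∈ P, max (-V (r p)) 0 ≤ α * a (σ p) := by
    intro p hp
    rcases Nat.eq_zero_or_eq_succ_pred (σ p) with h0 | hS
    · rw [h0, ha0, mul_one]
      have hr1 := hlong p hp
      have hr2 := hσ0 p h0
      have hw := hV.well (r p) ⟨hr1, hr2.le⟩
      exact max_le (by linarith) hα0.le
    · set d := (σ p).pred
      rw [hS, haS]
      obtain ⟨hd1, hd2⟩ := hσS p d hS
      have hd0 : (0 : ℝ) ≤ d := Nat.cast_nonneg _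
      have h43 : 4 / 3 ≤ r p := by linarith
      have hV1 := hV.abs_apply_le' h43
      have hrpos : 0 < r p := by linarith
      have hinv : (r p)⁻¹ ≤ ((d : ℝ) + 4 / 3)⁻¹ := inv_anti₀ (by positivity) hd1
      have hinv5 : (r p)⁻¹ ^ 5 ≤ ((d : ℝ) + 4 / 3)⁻¹ ^ 5 :=
        pow_le_pow_left₀ (inv_nonneg.2 hrpos.le) hinv 5
      have := (abs_le.1 hV1).1
      refine max_le ?_ (by positivity)
      nlinarith [mul_le_mul_of_nonneg_left hinv5 hα0.le]
  -- per shell: the count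
  have hcount0 : (((P.filter fun p => σ p = 0).card : ℕ) : ℝ) ≤
      B * (4 * (2 * (K * (4 / 3)) + 1) ^ 2) * (64 * (5 / 6 + 1)) := by
    refine card_pairs_le_of_near hα0 hα hsep (defects α y) _ (by positivity) (by norm_num) ?_
    intro p hp
    rw [Finset.mem_filter] at hp
    have hr2 := hσ0 p hp.2
    have hr1 := hlong p hp.1
    obtain ⟨b, hb, hbK⟩ := hnear p hp.1
    refine ⟨⟨b, hb, hbK.trans ?_⟩, ?_⟩
    · exact mul_le_mul_of_nonneg_left hr2.le hK
    · rw [abs_le]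
      constructor <;> simp only [hr] at hr1 hr2 ⊢ <;> linarith
  have hcountS : ∀ d : ℕ, (((P.filter fun p => σ p = d + 1).card : ℕ) : ℝ) ≤
      B * (4 * (2 * (K * ((d : ℝ) + 7 / 3)) + 1) ^ 2) * (64 * (((d : ℝ) + 11 / 6) + 1)) := by
    intro d
    refine card_pairs_le_of_near hα0 hα hsep (defects α y) _ (by positivity) (by positivity) ?_
    intro p hp
    rw [Finset.mem_filter] at hp
    obtain ⟨hd1, hd2⟩ := hσS p d hp.2
    obtain ⟨b, hb, hbK⟩ := hnear p hp.1
    refine ⟨⟨b, hb, hbK.trans ?_⟩, ?_⟩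
    · exact mul_le_mul_of_nonneg_left hd2.le hK
    · rw [abs_le]
      constructor <;> simp only [hr] at hd1 hd2 ⊢ <;> linarith
  -- the shell sum
  set D : ℕ := P.sup σ + 1 with hD
  have hmaps : ∀ p ∈ P, σ p ∈ Finset.range D := fun p hp =>
    Finset.mem_range.2 (Nat.lt_succ_of_le (Finset.le_sup hp))
  have hsplit : ∑ p ∈ P, max (-V (r p)) 0 =
      ∑ d ∈ Finset.range D, ∑ p ∈ P.filter (fun p => σ p = d), max (-V (r p)) 0 :=
    (Finset.sum_fiberwise_of_maps_to hmaps _).symm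
  have hshell : ∀ d ∈ Finset.range D,
      ∑ p ∈ P.filter (fun p => σ p = d), max (-V (r p)) 0 ≤
        α * a d * ((P.filter fun p => σ p = d).card : ℝ) := by
    intro d _
    have : ∀ p ∈ P.filter (fun p => σ p = d), max (-V (r p)) 0 ≤ α * a d := by
      intro p hp
      rw [Finset.mem_filter] at hp
      rw [← hp.2]
      exact hpair p hp.1
    calc ∑ p ∈ P.filter (fun p => σ p = d), max (-V (r p)) 0
        ≤ ∑ p ∈ P.filter (fun p => σ p = d), α * a d := Finset.sum_le_sum this
      _ = α * a d * ((P.filter fun p => σ p = d).card : ℝ) := by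
          rw [Finset.sum_const, nsmul_eq_mul]; ring
  -- shell bounds in closed form
  have hK1 : 1 ≤ 2 * K + 1 := by linarith
  have hterm0 : α * a 0 * ((P.filter fun p => σ p = 0).card : ℝ) ≤
      α * (1024 * (2 * K + 1) ^ 2 * B) := by
    rw [ha0, mul_one]
    refine mul_le_mul_of_nonneg_left (hcount0.trans ?_) hα0.le
    have hq : (2 * (K * (4 / 3)) + 1) ^ 2 ≤ 16 / 9 * (2 * K + 1) ^ 2 := by nlinarith
    have hKB : 0 ≤ (2 * K + 1) ^ 2 * B := mul_nonneg (sq_nonneg _) hB0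
    calc B * (4 * (2 * (K * (4 / 3)) + 1) ^ 2) * (64 * (5 / 6 + 1))
        = B * 4 * (64 * (11 / 6)) * (2 * (K * (4 / 3)) + 1) ^ 2 := by ring
      _ ≤ B * 4 * (64 * (11 / 6)) * (16 / 9 * (2 * K + 1) ^ 2) :=
          mul_le_mul_of_nonneg_left hq (by positivity)
      _ = 22528 / 27 * ((2 * K + 1) ^ 2 * B) := by ring
      _ ≤ 1024 * ((2 * K + 1) ^ 2 * B) := by nlinarith
      _ = 1024 * (2 * K + 1) ^ 2 * B := by ring
  have htermS : ∀ d : ℕ, α * a (d + 1) * ((P.filter fun p => σ p = d + 1).card : ℝ) ≤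
      α * (3072 * (2 * K + 1) ^ 2 * B * ((d : ℝ) + 4 / 3)⁻¹ ^ 2) := by
    intro d
    rw [haS]
    have hd0 : (0 : ℝ) ≤ d := Nat.cast_nonneg _
    set t : ℝ := (d : ℝ) + 4 / 3 with ht
    have ht0 : 0 < t := by positivity
    have hc := hcountS d
    -- `(2K(d+7/3)+1)² ≤ 4(2K+1)² t²`, `(d + 11/6 + 1) ≤ 3t`
    have h1 : 2 * (K * ((d : ℝ) + 7 / 3)) + 1 ≤ 2 * (2 * K + 1) * t := by
      rw [ht]; nlinarith
    have h1' : (2 * (K * ((d : ℝ) + 7 / 3)) + 1) ^ 2 ≤ (2 * (2 * K + 1) * t) ^ 2 :=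
      pow_le_pow_left₀ (by positivity) h1 2
    have h2 : ((d : ℝ) + 11 / 6) + 1 ≤ 3 * t := by rw [ht]; linarith
    have hcnt : (((P.filter fun p => σ p = d + 1).card : ℕ) : ℝ) ≤
        3072 * (2 * K + 1) ^ 2 * B * t ^ 3 := by
      refine hc.trans ?_
      have hB' : 0 ≤ B * 4 := by positivity
      calc B * (4 * (2 * (K * ((d : ℝ) + 7 / 3)) + 1) ^ 2) * (64 * (((d : ℝ) + 11 / 6) + 1))
          ≤ B * (4 * (2 * (2 * K + 1) * t) ^ 2) * (64 * (3 * t)) := by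
            apply mul_le_mul (mul_le_mul_of_nonneg_left (by nlinarith) hB0) (by nlinarith)
              (by positivity) (by positivity)
        _ = 3072 * (2 * K + 1) ^ 2 * B * t ^ 3 := by ring
    have hw : 0 ≤ α * t⁻¹ ^ 5 := by positivity
    calc α * t⁻¹ ^ 5 * (((P.filter fun p => σ p = d + 1).card : ℕ) : ℝ)
        ≤ α * t⁻¹ ^ 5 * (3072 * (2 * K + 1) ^ 2 * B * t ^ 3) :=
          mul_le_mul_of_nonneg_left hcnt hw
      _ = α * (3072 * (2 * K + 1) ^ 2 * B * t⁻¹ ^ 2) := by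
          have e : t⁻¹ ^ 5 * t ^ 3 = t⁻¹ ^ 2 := by
            rw [show (5 : ℕ) = 2 + 3 from rfl, pow_add, mul_assoc, ← mul_pow,
              inv_mul_cancel₀ ht0.ne', one_pow, mul_one]
          calc α * t⁻¹ ^ 5 * (3072 * (2 * K + 1) ^ 2 * B * t ^ 3)
              = α * (3072 * (2 * K + 1) ^ 2 * B) * (t⁻¹ ^ 5 * t ^ 3) := by ring
            _ = α * (3072 * (2 * K + 1) ^ 2 * B * t⁻¹ ^ 2) := by rw [e]; ring
  -- assemble
  rw [hsplit]
  have hD1 : 1 ≤ D := by rw [hD]; omega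
  calc ∑ d ∈ Finset.range D, ∑ p ∈ P.filter (fun p => σ p = d), max (-V (r p)) 0
      ≤ ∑ d ∈ Finset.range D, α * a d * ((P.filter fun p => σ p = d).card : ℝ) :=
        Finset.sum_le_sum hshell
    _ = α * a 0 * ((P.filter fun p => σ p = 0).card : ℝ) +
          ∑ d ∈ Finset.range (D - 1), α * a (d + 1) * ((P.filter fun p => σ p = d + 1).card : ℝ) := by
        obtain ⟨D', hD'⟩ : ∃ D', D = D' + 1 := ⟨D - 1, by omega⟩
        rw [hD', Finset.sum_range_succ', Nat.add_sub_cancel, add_comm]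
    _ ≤ α * (1024 * (2 * K + 1) ^ 2 * B) +
          ∑ d ∈ Finset.range (D - 1), α * (3072 * (2 * K + 1) ^ 2 * B * ((d : ℝ) + 4 / 3)⁻¹ ^ 2) :=
        add_le_add hterm0 (Finset.sum_le_sum fun d _ => htermS d)
    _ = α * (1024 * (2 * K + 1) ^ 2 * B) + α * (3072 * (2 * K + 1) ^ 2 * B) *
          ∑ d ∈ Finset.range (D - 1), ((d : ℝ) + 4 / 3)⁻¹ ^ 2 := by
        rw [Finset.mul_sum]
        exact congrArg _ (Finset.sum_congr rfl fun d _ => by ring)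
    _ ≤ α * (1024 * (2 * K + 1) ^ 2 * B) + α * (3072 * (2 * K + 1) ^ 2 * B) * 3 := by
        have h3 := sum_range_inv_add_sq_le (D - 1)
        have hw : 0 ≤ α * (3072 * (2 * K + 1) ^ 2 * B) := by positivity
        nlinarith [mul_le_mul_of_nonneg_left h3 hw]
    _ = 10240 * (2 * K + 1) ^ 2 * α * B := by ring

/-- **(41) in the printed shape**: with weights `w_p ∈ [0, 1]` (`1` on `ℒ₀`, `½` on `ℒ₁`),
`Σ_{p ∈ P} w_p e(p) ≥ −10240 (2K+1)² α #∂X`. [cite: Theil2006, §2.4 (41) (preprint p. 12); constants ours] -/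
theorem IsAdmissible.sum_mul_ge_of_near_defects (hV : IsAdmissible α V) (hα0 : 0 < α)
    (hα : α ≤ 1 / 2) (hsep : ∀ i j : Fin N, i ≠ j → 1 - α < dist (y i) (y j))
    (P : Finset (Fin N × Fin N)) (hlong : ∀ p ∈ P, 1 + α ≤ dist (y p.1) (y p.2)) {K : ℝ}
    (hK : 0 ≤ K)
    (hnear : ∀ p ∈ P, ∃ b ∈ defects α y, dist (y p.1) (y b) ≤ K * dist (y p.1) (y p.2))
    {w : Fin N × Fin N → ℝ} (hw0 : ∀ p ∈ P, 0 ≤ w p) (hw1 : ∀ p ∈ P, w p ≤ 1) :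
    -(10240 * (2 * K + 1) ^ 2 * α * (defects α y).card) ≤
      ∑ p ∈ P, w p * V (dist (y p.1) (y p.2)) := by
  have h := hV.sum_negPart_le_of_near_defects hα0 hα hsep P hlong hK hnear
  have hle : ∀ p ∈ P, -max (-V (dist (y p.1) (y p.2))) 0 ≤ w p * V (dist (y p.1) (y p.2)) := by
    intro p hp
    have h0 := hw0 p hp
    have h1 := hw1 p hp
    by_cases hv : 0 ≤ V (dist (y p.1) (y p.2))
    · rw [max_eq_right (by linarith)]
      nlinarith
    · rw [not_le] at hv
      rw [max_eq_left (by linarith)]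
      nlinarith
  have := Finset.sum_le_sum hle
  rw [Finset.sum_neg_distrib] at this
  linarith

end LongRangePairs

end Theil2006

end Literature.MathematicalPhysics.StatisticalMechanics

end
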